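import Mathlib.Algebra.Lie.UniversalEnveloping
import Mathlib.RingTheory.MvPolynomial.Basic
import Mathlib.Data.Finsupp.Weight
import Mathlib.Data.Finsupp.Multiset
import Mathlib.Data.Multiset.Sort
import Mathlib.Tactic.LinearCombination
import Mathlib.Tactic.Ring
import Mathlib.Tactic.Abel
import HarnessLib

/-!
# The Poincaré–Birkhoff–Witt theorem

Let `L` be a Lie algebra over a commutative ring `R` which is free as an `R`-module, with a basis
`b : Module.Basis σ R L` indexed by a linearly ordered type `σ` (`x_i := b i`). The
**Poincaré–Birkhoff–Witt theorem** (Humphreys, *Introduction to Lie Algebras and Representation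
Theory*, §17.3 Theorem and Corollary C; Bourbaki, LIE I §2.7 Th. 1) says that the *ordered
monomials* `ι(x_{i₁}) ι(x_{i₂}) ⋯ ι(x_{i_k})`, `i₁ ≤ i₂ ≤ ⋯ ≤ i_k`, `k ≥ 0`, form an `R`-basis of the
universal enveloping algebra `U(L) = UniversalEnvelopingAlgebra R L`. Mathlib (pinned revision)
has `U(L)` with its universal property and nothing more; this file proves the theorem.

We follow Humphreys' proof (§17.4, which works verbatim over any commutative ring, no division
being used): one constructs a representation of `L` on the polynomial algebra
`S = MvPolynomial σ R` (`z_i ↔ x_i`) such that `x_i · z_s = z_i z_s` whenever `i ≤ s`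
(Lemmas 17.4.A–C: the operators `f_m` are built by recursion on the degree `m`, conditions
(A_m), (B_m) and the compatibility `f_{m+1}|_{S_m} = f_m` are proved by induction on `m`, and the
commutation condition (C_m) — the heart of the matter, Lemma 17.4.B, using the Jacobi identity —
by strong induction on the degree). Evaluating `U(L) → End(S)` at `1 ∈ S` sends the ordered
monomial `x_s` to the monomial `z_s`, whence linear independence; spanning is the usual
straightening argument (§17.3 Lemma / Lemma 17.4.D), which we prove in filtered form.

## Main definitions

* `Literature.PBW.ρ b : L →ₗ⁅R⁆ Module.End R (MvPolynomial σ R)` — Humphreys' representation of `L` on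
  `S(L)` (Lemma 17.4.C), with `act_monomial_of_leAll : x_i · z_s = z_i z_s` for `i ≤ s`.
* `Literature.PBW.word b l` — the product `ι(x_{l₁}) ⋯ ι(x_{l_k})` of a list of indices;
  `Literature.PBW.ordMonomial b s` — the ordered monomial of a multi-index `s : σ →₀ ℕ`.
* `Literature.PBW.pbwBasis b : Module.Basis (σ →₀ ℕ) R (UniversalEnvelopingAlgebra R L)` — **the PBW
  basis** (`pbwBasis_apply : pbwBasis b s = ordMonomial b s`).
* `Literature.PBW.fil b k` — the standard filtration `U_k` (span of words of length `≤ k`), with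
  `fil_eq_span_word`, `fil_eq_span_ordMonomial`, `mem_fil_iff_repr`, `mul_mem_fil`.

## Main statements

* `Literature.Algebra.Lie.PBW.linearIndependent_ordMonomial`, `Literature.Algebra.Lie.PBW.span_ordMonomial_eq_top` — the two halves
  of PBW (Humphreys §17.3 Corollary C).
* `Literature.Algebra.Lie.PBW.word_sub_ordMonomial_mem` — straightening: a word of length `k + 1` is congruent to
  its ordered rearrangement modulo `U_k` (so `gr U(L)` is commutative and generated by symbols).
* `Literature.Algebra.Lie.PBW.ι_injective` — `ι : L → U(L)` is injective (Humphreys §17.3 Corollary B).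

## Implementation notes

* The operators `f_m` of Lemma 17.4.A are defined on *all* of `S` (by `Module.Basis.constr` on
  the monomial basis), level by level (`F b m`); only their values in degrees `≤ m` matter, and
  `Fω` is their union. The "defect" `x·(y·p) - y·(x·p) - [x,y]·p` is packaged as a bilinear map
  (`defect`) so that condition (C) for basis vectors propagates to all of `L` by `Module.Basis.ext`.
* Everything is stated for an arbitrary linear order on `σ`; no well-ordering is needed.
* Namespace `Literature.PBW`; nothing is added to Mathlib namespaces.

## References

* J. E. Humphreys, *Introduction to Lie Algebras and Representation Theory*, GTM 9, Springer
  1972, §17.2–§17.4 (Theorem 17.3 (PBW), Corollaries A–C, Lemmas 17.4.A–D).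
* N. Bourbaki, *Lie Groups and Lie Algebras, Chapters 1–3*, Ch. I §2.7, Théorème 1.
-/

noncomputable section

open MvPolynomial Finsupp

-- Mathlib idiom (Mathlib/Algebra/Lie/OfAssociative.lean, UniversalEnveloping.lean): the commutator
-- bracket on associative rings such as `Module.End R S` and the enveloping algebra
attribute [local instance 100] LieRing.ofAssociativeRing

namespace Literature.Algebra.Lie.PBW

variable {σ : Type*} {R : Type*} [CommRing R]

/-! ### Combinatorics of multi-indices `σ →₀ ℕ` over a linearly ordered index type -/

section MultiIndex

variable [LinearOrder σ]

/-- `LEAll i s`: the index `i` is `≤` every index occurring in the multi-index `s`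
(Humphreys writes `i ≤ M` for a sequence `M`). [folklore] -/
def LEAll (i : σ) (s : σ →₀ ℕ) : Prop :=
  ∀ k ∈ s.support, i ≤ k

/-- `LEAll i s` is decidable (it quantifies over the finite support). [folklore] -/
instance (i : σ) (s : σ →₀ ℕ) : Decidable (LEAll i s) :=
  inferInstanceAs (Decidable (∀ k ∈ s.support, i ≤ k))

/-- Every index is `≤` the empty multi-index. [folklore] -/
theorem leAll_zero (i : σ) : LEAll i 0 := by
  simp [LEAll]

/-- The support of `single j 1 + t` is `insert j t.support`. [folklore] -/
theorem support_single_one_add (j : σ) (t : σ →₀ ℕ) :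
    (single j 1 + t).support = insert j t.support := by
  ext k
  simp only [Finsupp.mem_support_iff, Finsupp.add_apply, Finsupp.single_apply, Finset.mem_insert]
  by_cases h : j = k
  · subst h
    simp
  · simp [h, Ne.symm h]

/-- `i ≤ (j, t)` iff `i ≤ j` and `i ≤ t`. [folklore] -/
theorem leAll_single_add_iff {i j : σ} {t : σ →₀ ℕ} :
    LEAll i (single j 1 + t) ↔ i ≤ j ∧ LEAll i t := by
  simp [LEAll, support_single_one_add]

/-- `LEAll` is antitone in the index. [folklore] -/
theorem LEAll.mono {i j : σ} {t : σ →₀ ℕ} (h : LEAll j t) (hij : i ≤ j) : LEAll i t :=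
  fun k hk ↦ hij.trans (h k hk)

/-- A multi-index which is not `≥ i` is nonzero. [folklore] -/
theorem support_nonempty_of_not_leAll {i : σ} {s : σ →₀ ℕ} (h : ¬LEAll i s) :
    s.support.Nonempty := by
  by_contra h'
  rw [Finset.not_nonempty_iff_eq_empty] at h'
  exact h fun k hk ↦ by simp [h'] at hk

/-- The least index occurring in `s` (with junk value `i` when `s = 0`). [folklore] -/
def minIdx (i : σ) (s : σ →₀ ℕ) : σ :=
  if h : s.support.Nonempty then s.support.min' h else i

/-- `s` with one occurrence of its least index removed. [folklore] -/
def rest (i : σ) (s : σ →₀ ℕ) : σ →₀ ℕ :=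
  s - single (minIdx i s) 1

/-- The least index of `(j, t)` with `j ≤ t` is `j`. [folklore] -/
theorem minIdx_single_add {i j : σ} {t : σ →₀ ℕ} (hjt : LEAll j t) :
    minIdx i (single j 1 + t) = j := by
  have hne : (single j 1 + t).support.Nonempty := ⟨j, by simp [support_single_one_add]⟩
  rw [minIdx, dif_pos hne]
  refine le_antisymm (Finset.min'_le _ _ (by simp [support_single_one_add])) ?_
  refine Finset.le_min' _ _ _ fun k hk ↦ ?_
  rw [support_single_one_add, Finset.mem_insert] at hk
  rcases hk with rfl | hk
  · exact le_rfl
  · exact hjt k hk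

/-- Removing the least index from `(j, t)` with `j ≤ t` leaves `t`. [folklore] -/
theorem rest_single_add {i j : σ} {t : σ →₀ ℕ} (hjt : LEAll j t) :
    rest i (single j 1 + t) = t := by
  rw [rest, minIdx_single_add hjt, add_tsub_cancel_left]

/-- Splitting off the least index: every nonzero multi-index is `single j 1 + t` with `j ≤ t`.
[folklore] -/
theorem exists_eq_single_add {s : σ →₀ ℕ} (hs : s.support.Nonempty) :
    ∃ j t, s = single j 1 + t ∧ LEAll j t ∧ j ∈ s.support := by
  refine ⟨s.support.min' hs, s - single (s.support.min' hs) 1, ?_, ?_, Finset.min'_mem _ _⟩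
  · rw [add_tsub_cancel_of_le]
    rw [Finsupp.single_le_iff]
    exact Nat.one_le_iff_ne_zero.mpr (Finsupp.mem_support_iff.mp (Finset.min'_mem _ _))
  · intro k hk
    refine Finset.min'_le _ _ (Finset.mem_of_subset (Finsupp.support_tsub) hk)

/-- If `s` is not `≥ i`, then `s = (j, t)` with `j ≤ t` and `j < i` (Humphreys' case distinction in
the proof of Lemma 17.4.A). [cite: Humphreys1972, §17.4, proof of Lemma A] -/
theorem exists_eq_single_add_of_not_leAll {i : σ} {s : σ →₀ ℕ} (h : ¬LEAll i s) :
    ∃ j t, s = single j 1 + t ∧ LEAll j t ∧ j < i := by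
  obtain ⟨j, t, rfl, hjt, -⟩ := exists_eq_single_add (support_nonempty_of_not_leAll h)
  refine ⟨j, t, rfl, hjt, ?_⟩
  by_contra hij
  exact h (leAll_single_add_iff.mpr ⟨not_lt.mp hij, hjt.mono (not_lt.mp hij)⟩)

omit [LinearOrder σ] in
/-- `deg (j, t) = deg t + 1`. [folklore] -/
theorem degree_single_add (j : σ) (t : σ →₀ ℕ) : (single j 1 + t).degree = t.degree + 1 := by
  rw [map_add, degree_single, add_comm]

/-- Induction on multi-indices by splitting off the least index. [folklore] -/
theorem induction_on_min {p : (σ →₀ ℕ) → Prop} (s : σ →₀ ℕ) (h0 : p 0)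
    (hadd : ∀ j t, LEAll j t → p t → p (single j 1 + t)) : p s := by
  induction hn : s.degree using Nat.strong_induction_on generalizing s with
  | _ n ih =>
    by_cases hs : s.support.Nonempty
    · obtain ⟨j, t, rfl, hjt, -⟩ := exists_eq_single_add hs
      refine hadd j t hjt (ih t.degree ?_ t rfl)
      rw [← hn, degree_single_add]
      exact Nat.lt_succ_self _
    · rw [Finset.not_nonempty_iff_eq_empty, Finsupp.support_eq_empty] at hs
      rw [hs]
      exact h0

end MultiIndex

/-! ### The degree filtration of the polynomial algebra -/

section Degree

variable (σ R) in
/-- `D k`: polynomials all of whose monomials have degree `≤ k` (this is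
`MvPolynomial.restrictTotalDegree`, phrased with `Finsupp.degree`). [folklore] -/
def D (k : ℕ) : Submodule R (MvPolynomial σ R) :=
  restrictSupport R {s | s.degree ≤ k}

/-- Membership in `D k`: all monomials have degree `≤ k`. [folklore] -/
theorem mem_D_iff {k : ℕ} {p : MvPolynomial σ R} : p ∈ D σ R k ↔ ∀ s ∈ p.support, s.degree ≤ k := by
  rw [D, mem_restrictSupport_iff]
  exact Iff.rfl

/-- The degree filtration is increasing. [folklore] -/
theorem D_mono : Monotone (D σ R) := fun _ _ h ↦
  restrictSupport_mono R fun _ hs ↦ le_trans hs h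

/-- Monomials of degree `≤ k` lie in `D k`. [folklore] -/
theorem monomial_mem_D {k : ℕ} {s : σ →₀ ℕ} (h : s.degree ≤ k) (r : R) : monomial s r ∈ D σ R k := by
  rw [D, monomial_mem_restrictSupport]
  exact Or.inl h

/-- `D k` is spanned by the monic monomials of degree `≤ k`. [folklore] -/
theorem D_eq_span (k : ℕ) : D σ R k = Submodule.span R ((monomial · (1 : R)) '' {s | s.degree ≤ k}) :=
  restrictSupport_eq_span R _

/-- Multiplication by a variable raises the degree filtration by one. [folklore] -/
theorem X_mul_mem_D {k : ℕ} {p : MvPolynomial σ R} (hp : p ∈ D σ R k) (i : σ) :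
    X i * p ∈ D σ R (k + 1) := by
  rw [mem_D_iff] at hp ⊢
  intro s hs
  rw [support_X_mul, Finset.mem_map] at hs
  obtain ⟨t, ht, rfl⟩ := hs
  rw [addLeftEmbedding_apply, degree_single_add]
  exact Nat.succ_le_succ (hp t ht)

/-- `z_i · z_s = z_{(i, s)}`. [folklore] -/
theorem X_mul_monomial (i : σ) (s : σ →₀ ℕ) :
    (X i : MvPolynomial σ R) * monomial s 1 = monomial (single i 1 + s) 1 := by
  rw [monomial_single_add, pow_one]

/-- Two linear maps agreeing on the monomials of degree `≤ k` agree on `D k`. [folklore] -/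
theorem eqOn_D {N : Type*} [AddCommGroup N] [Module R N] {k : ℕ}
    {f g : MvPolynomial σ R →ₗ[R] N}
    (h : ∀ s : σ →₀ ℕ, s.degree ≤ k → f (monomial s 1) = g (monomial s 1)) :
    ∀ p ∈ D σ R k, f p = g p := by
  intro p hp
  rw [D_eq_span] at hp
  refine LinearMap.eqOn_span ?_ hp
  rintro _ ⟨s, hs, rfl⟩
  exact h s hs

/-- A linear map sending the monomials of degree `≤ k` into a submodule `N'` maps `D k` into `N'`.
[folklore] -/
theorem map_mem_of_monomial {N : Type*} [AddCommGroup N] [Module R N] {k : ℕ}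
    {f : MvPolynomial σ R →ₗ[R] N} {N' : Submodule R N}
    (h : ∀ s : σ →₀ ℕ, s.degree ≤ k → f (monomial s 1) ∈ N') :
    ∀ p ∈ D σ R k, f p ∈ N' := by
  intro p hp
  rw [D_eq_span] at hp
  refine Submodule.span_induction ?_ (by simp) (fun x y _ _ hx hy ↦ ?_) (fun a x _ hx ↦ ?_) hp
  · rintro _ ⟨s, hs, rfl⟩
    exact h s hs
  · rw [map_add]
    exact add_mem hx hy
  · rw [map_smul]
    exact N'.smul_mem a hx

end Degree

/-! ### Humphreys' operators `f_m` (Lemma 17.4.A) -/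

section Construction

variable {L : Type*} [LieRing L] [LieAlgebra R L] (b : Module.Basis σ R L)

local notation "S" => MvPolynomial σ R

/-- Extend a family of operators `F i` (the action of the basis vector `b i`) linearly to all of
`L`: `x ↦ ∑ᵢ (b.repr x i) • F i`. [folklore] -/
def extend (F : σ → S →ₗ[R] S) : L →ₗ[R] (S →ₗ[R] S) :=
  Finsupp.linearCombination R F ∘ₗ b.repr.toLinearMap

/-- The extension of `F` agrees with `F i` on the basis vector `b i`. [folklore] -/
@[simp]
theorem extend_basis (F : σ → S →ₗ[R] S) (i : σ) : extend b F (b i) = F i := by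
  simp [extend]

/-- The extension of `F` evaluated: `x · p = ∑ᵢ (b.repr x i) • F i p`. [folklore] -/
theorem extend_apply (F : σ → S →ₗ[R] S) (x : L) (p : S) :
    extend b F x p = (b.repr x).sum fun k c ↦ c • F k p := by
  simp [extend, Finsupp.linearCombination_apply, Finsupp.sum, LinearMap.sum_apply,
    LinearMap.smul_apply]

/-- Two families that agree at `p` have extensions that agree at `p`. [folklore] -/
theorem extend_apply_congr {F G : σ → S →ₗ[R] S} {p : S} (h : ∀ k, F k p = G k p) (x : L) :
    extend b F x p = extend b G x p := by
  simp only [extend_apply, h]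

/-- If all `F k p` lie in a submodule, so does `x · p` for every `x ∈ L`. [folklore] -/
theorem extend_apply_mem {F : σ → S →ₗ[R] S} {p : S} {N : Submodule R S}
    (h : ∀ k, F k p ∈ N) (x : L) : extend b F x p ∈ N := by
  rw [extend_apply]
  exact Submodule.sum_mem _ fun k _ ↦ N.smul_mem _ (h k)

variable [LinearOrder σ]

/-- One step of Humphreys' recursion (proof of Lemma 17.4.A): given the operators `F = f_m`
(correct in degrees `≤ m`), the operator `f_{m+1}(x_i ⊗ -)` on monomials `z_s`:
`z_i z_s` if `i ≤ s`, and otherwise, writing `s = (j, t)` with `j = min s < i`,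
`z_i z_s + f_m(x_j ⊗ (f_m(x_i ⊗ z_t) - z_i z_t)) + f_m([x_i, x_j] ⊗ z_t)`.
[cite: Humphreys1972, §17.4, proof of Lemma A] -/
def step (F : σ → S →ₗ[R] S) (i : σ) : S →ₗ[R] S :=
  (basisMonomials σ R).constr R fun s ↦
    if LEAll i s then X i * monomial s 1
    else X i * monomial s 1 +
      (F (minIdx i s) (F i (monomial (rest i s) 1) - X i * monomial (rest i s) 1) +
        extend b F ⁅b i, b (minIdx i s)⁆ (monomial (rest i s) 1))

/-- Humphreys' operators `f_m(x_i ⊗ -)`, `m : ℕ`, `i : σ`, as linear endomorphisms of the whole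
polynomial algebra (only their values in degrees `≤ m` matter). [cite: Humphreys1972, §17.4, Lemma A] -/
def F : ℕ → σ → S →ₗ[R] S
  | 0 => fun i ↦ LinearMap.mulLeft R (X i)
  | m + 1 => step b (F m)

/-- The value of `step` on a monomial (unfolding `Module.Basis.constr`). [cite: Humphreys1972,
§17.4, proof of Lemma A] -/
theorem step_monomial (F : σ → S →ₗ[R] S) (i : σ) (s : σ →₀ ℕ) :
    step b F i (monomial s 1) =
      if LEAll i s then X i * monomial s 1
      else X i * monomial s 1 +
        (F (minIdx i s) (F i (monomial (rest i s) 1) - X i * monomial (rest i s) 1) +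
          extend b F ⁅b i, b (minIdx i s)⁆ (monomial (rest i s) 1)) := by
  have key := fun f : (σ →₀ ℕ) → S ↦ Module.Basis.constr_basis (basisMonomials σ R) R f s
  simp only [coe_basisMonomials] at key
  rw [step]
  exact key _

/-- Condition (A_m): `f_m(x_i ⊗ z_s) = z_i z_s` whenever `i ≤ s`. [cite: Humphreys1972, §17.4, Lemma A (A_m)] -/
theorem F_monomial_of_leAll (m : ℕ) {i : σ} {s : σ →₀ ℕ} (h : LEAll i s) :
    F b m i (monomial s 1) = X i * monomial s 1 := by
  cases m with
  | zero => simp [F]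
  | succ m => rw [F, step_monomial, if_pos h]

/-- The recursion defining `f_{m+1}` on a monomial `z_j z_t`, `j ≤ t`, `j < i`.
[cite: Humphreys1972, §17.4, proof of Lemma A] -/
theorem F_succ_monomial {m : ℕ} {i j : σ} {t : σ →₀ ℕ} (hji : j < i) (hjt : LEAll j t) :
    F b (m + 1) i (monomial (single j 1 + t) 1) =
      X i * monomial (single j 1 + t) 1 +
        (F b m j (F b m i (monomial t 1) - X i * monomial t 1) +
          extend b (F b m) ⁅b i, b j⁆ (monomial t 1)) := by
  have h : ¬LEAll i (single j 1 + t) := fun h ↦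
    (lt_irrefl j) (lt_of_lt_of_le hji (leAll_single_add_iff.mp h).1)
  rw [F, step_monomial, if_neg h, minIdx_single_add hjt, rest_single_add hjt]

/-- Conditions (B_m) and the compatibility `f_{m+1}|_{S_m} = f_m` of Humphreys' Lemma 17.4.A:
`f_m(x_i ⊗ z_s) - z_i z_s` has degree `≤ deg s` for `deg s ≤ m`, and `f_{m+1}` extends `f_m`.
[cite: Humphreys1972, §17.4, Lemma A] -/
theorem F_sub_mem_D_and_F_succ_eq (m : ℕ) :
    (∀ (i : σ) (s : σ →₀ ℕ), s.degree ≤ m →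
        F b m i (monomial s 1) - X i * monomial s 1 ∈ D σ R s.degree) ∧
      ∀ (i : σ) (s : σ →₀ ℕ), s.degree ≤ m →
        F b (m + 1) i (monomial s 1) = F b m i (monomial s 1) := by
  induction m with
  | zero =>
    have h0 : ∀ s : σ →₀ ℕ, s.degree ≤ 0 → s = 0 := fun s hs ↦
      (Finsupp.degree_eq_zero_iff s).mp (Nat.le_zero.mp hs)
    constructor
    · intro i s hs
      rw [h0 s hs, F_monomial_of_leAll b 0 (leAll_zero i), sub_self]
      exact zero_mem _
    · intro i s hs
      rw [h0 s hs, F_monomial_of_leAll b 1 (leAll_zero i), F_monomial_of_leAll b 0 (leAll_zero i)]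
  | succ m ih =>
    obtain ⟨hB, hC⟩ := ih
    -- (St_m): `f_m` raises degrees `≤ m` by at most one
    have hSt : ∀ (i : σ) (k : ℕ), k ≤ m → ∀ p ∈ D σ R k, F b m i p ∈ D σ R (k + 1) := by
      intro i k hk
      refine map_mem_of_monomial fun s hs ↦ ?_
      have := hB i s (hs.trans hk)
      rw [← sub_add_cancel (F b m i (monomial s 1)) (X i * monomial s 1)]
      exact add_mem (D_mono (Nat.le_succ_of_le hs) this)
        (X_mul_mem_D (monomial_mem_D hs 1) i)
    -- compatibility on all of `D m`
    have hC' : ∀ (i : σ), ∀ p ∈ D σ R m, F b (m + 1) i p = F b m i p := fun i ↦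
      eqOn_D (hC i)
    constructor
    · intro i s hs
      rcases hs.lt_or_eq with hlt | heq
      · rw [hC i s (Nat.lt_succ_iff.mp hlt)]
        exact hB i s (Nat.lt_succ_iff.mp hlt)
      by_cases hle : LEAll i s
      · rw [F_monomial_of_leAll b _ hle, sub_self]
        exact zero_mem _
      obtain ⟨j, t, rfl, hjt, hji⟩ := exists_eq_single_add_of_not_leAll hle
      rw [degree_single_add] at heq ⊢
      have ht : t.degree = m := by omega
      rw [F_succ_monomial b hji hjt, add_sub_cancel_left, ht]
      exact add_mem (hSt j m le_rfl _ (D_mono ht.le (hB i t ht.le)))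
        (extend_apply_mem b (fun k ↦ hSt k m le_rfl _ (monomial_mem_D ht.le 1)) _)
    · intro i s hs
      by_cases hle : LEAll i s
      · rw [F_monomial_of_leAll b _ hle, F_monomial_of_leAll b _ hle]
      obtain ⟨j, t, rfl, hjt, hji⟩ := exists_eq_single_add_of_not_leAll hle
      rw [degree_single_add] at hs
      have ht : t.degree ≤ m := by omega
      rw [F_succ_monomial b hji hjt, F_succ_monomial b hji hjt, hC i t ht,
        hC' j _ (D_mono ht (hB i t ht))]
      congr 2
      exact extend_apply_congr b (fun k ↦ hC k t ht) _

/-! ### The representation of `L` on `S(L)` (Humphreys' Lemmas 17.4.B–C) -/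

/-- The action of the basis vector `x_i` on the polynomial algebra: the union of Humphreys'
`f_m(x_i ⊗ -)` over `m`. [cite: Humphreys1972, §17.4, Lemma A] -/
def Fω (i : σ) : S →ₗ[R] S :=
  (basisMonomials σ R).constr R fun s ↦ F b s.degree i (monomial s 1)

/-- `Fω` on a monomial of degree `m` is `f_m`. [cite: Humphreys1972, §17.4, Lemma A] -/
theorem Fω_monomial (i : σ) (s : σ →₀ ℕ) :
    Fω b i (monomial s 1) = F b s.degree i (monomial s 1) := by
  have key := fun f : (σ →₀ ℕ) → S ↦ Module.Basis.constr_basis (basisMonomials σ R) R f s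
  simp only [coe_basisMonomials] at key
  rw [Fω]
  exact key _

/-- `Fω` agrees with `f_m` on monomials of degree `≤ m` (compatibility of the `f_m`). [cite:
Humphreys1972, §17.4, Lemma A] -/
theorem Fω_monomial_eq {m : ℕ} (i : σ) {s : σ →₀ ℕ} (h : s.degree ≤ m) :
    Fω b i (monomial s 1) = F b m i (monomial s 1) := by
  rw [Fω_monomial]
  obtain ⟨d, rfl⟩ := Nat.exists_eq_add_of_le h
  induction d with
  | zero => rfl
  | succ d ih =>
    rw [ih (Nat.le_add_right _ _), ← add_assoc]
    exact ((F_sub_mem_D_and_F_succ_eq b _).2 i s (Nat.le_add_right _ _)).symm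

/-- `Fω` agrees with `f_m` on `S_m = D m`. [cite: Humphreys1972, §17.4, Lemma A] -/
theorem Fω_eq_of_mem_D {m : ℕ} (i : σ) {p : S} (hp : p ∈ D σ R m) : Fω b i p = F b m i p :=
  eqOn_D (fun _ hs ↦ Fω_monomial_eq b i hs) p hp

/-- The action of `L` on `S = R[z_i : i ∈ σ]` by linear endomorphisms (a Lie algebra
representation, see `ρ`). [cite: Humphreys1972, §17.4, Lemmas A–C] -/
def act : L →ₗ[R] (S →ₗ[R] S) :=
  extend b (Fω b)

/-- The action of a basis vector `x_i` is `Fω i`. [folklore] -/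
theorem act_basis (i : σ) : act b (b i) = Fω b i :=
  extend_basis b _ i

/-- (A): `x_i · z_s = z_i z_s` for `i ≤ s`. [cite: Humphreys1972, §17.4, Lemma A (A_m)] -/
theorem act_monomial_of_leAll {i : σ} {s : σ →₀ ℕ} (h : LEAll i s) :
    act b (b i) (monomial s 1) = X i * monomial s 1 := by
  rw [act_basis, Fω_monomial, F_monomial_of_leAll b _ h]

/-- (B): `x_i · z_s - z_i z_s` has degree `≤ deg s`. [cite: Humphreys1972, §17.4, Lemma A (B_m)] -/
theorem act_monomial_sub_mem_D (i : σ) (s : σ →₀ ℕ) :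
    act b (b i) (monomial s 1) - X i * monomial s 1 ∈ D σ R s.degree := by
  rw [act_basis, Fω_monomial]
  exact (F_sub_mem_D_and_F_succ_eq b _).1 i s le_rfl

/-- The action of a basis vector raises degrees by at most one. [cite: Humphreys1972, §17.4, Lemma A
(B_m)] -/
theorem act_basis_mem_D {k : ℕ} (i : σ) {p : S} (hp : p ∈ D σ R k) :
    act b (b i) p ∈ D σ R (k + 1) := by
  refine map_mem_of_monomial (fun s hs ↦ ?_) p hp
  rw [← sub_add_cancel (act b (b i) (monomial s 1)) (X i * monomial s 1)]
  exact add_mem (D_mono (Nat.le_succ_of_le hs) (act_monomial_sub_mem_D b i s))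
    (X_mul_mem_D (monomial_mem_D hs 1) i)

/-- The action raises degrees by at most one. [cite: Humphreys1972, §17.4, Lemma A] -/
theorem act_mem_D {k : ℕ} (x : L) {p : S} (hp : p ∈ D σ R k) : act b x p ∈ D σ R (k + 1) :=
  extend_apply_mem b (fun i ↦ by simpa only [act_basis] using act_basis_mem_D b i hp) x

/-- The recursion: for `j < i` and `j ≤ t`,
`x_i · (z_j z_t) = z_i z_j z_t + x_j · (x_i · z_t - z_i z_t) + [x_i, x_j] · z_t`.
[cite: Humphreys1972, §17.4, proof of Lemma A] -/
theorem act_monomial_single_add {i j : σ} {t : σ →₀ ℕ} (hji : j < i) (hjt : LEAll j t) :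
    act b (b i) (monomial (single j 1 + t) 1) =
      X i * monomial (single j 1 + t) 1 +
        (act b (b j) (act b (b i) (monomial t 1) - X i * monomial t 1) +
          act b ⁅b i, b j⁆ (monomial t 1)) := by
  rw [act_basis, act_basis, Fω_monomial, degree_single_add, F_succ_monomial b hji hjt,
    Fω_monomial,
    Fω_eq_of_mem_D b j ((F_sub_mem_D_and_F_succ_eq b _).1 i t le_rfl)]
  congr 2
  exact extend_apply_congr b (fun k ↦ (Fω_monomial b k t).symm) _

/-- The "defect" `(x, y) ↦ x·(y·p) - y·(x·p) - [x,y]·p` as a bilinear map; the action is a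
representation iff it vanishes. [folklore] -/
def defect (p : S) : L →ₗ[R] L →ₗ[R] S :=
  LinearMap.mk₂ R (fun x y ↦ act b x (act b y p) - act b y (act b x p) - act b ⁅x, y⁆ p)
    (fun x₁ x₂ y ↦ by simp only [map_add, add_lie, LinearMap.add_apply]; abel)
    (fun c x y ↦ by simp only [map_smul, smul_lie, LinearMap.smul_apply, smul_sub])
    (fun x y₁ y₂ ↦ by simp only [map_add, lie_add, LinearMap.add_apply]; abel)
    (fun c x y ↦ by simp only [map_smul, lie_smul, LinearMap.smul_apply, smul_sub])

/-- Unfolding the defect. [folklore] -/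
theorem defect_apply (p : S) (x y : L) :
    defect b p x y = act b x (act b y p) - act b y (act b x p) - act b ⁅x, y⁆ p :=
  rfl

/-- The defect at `p`, as a linear function of `p`. [folklore] -/
def defectL (x y : L) : S →ₗ[R] S :=
  act b x ∘ₗ act b y - act b y ∘ₗ act b x - act b ⁅x, y⁆

/-- Unfolding the defect (as a function of `p`). [folklore] -/
theorem defectL_apply (x y : L) (p : S) : defectL b x y p = defect b p x y :=
  rfl

/-- A bilinear map vanishing on pairs of basis vectors vanishes. [folklore] -/
theorem defect_eq_zero_of_basis {p : S} (h : ∀ i j, defect b p (b i) (b j) = 0) :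
    defect b p = 0 :=
  b.ext fun i ↦ b.ext fun j ↦ by rw [h]; rfl

/-- If the defect vanishes for basis pairs on all monomials of degree `≤ k`, it vanishes for all
pairs of elements of `L` on `D k`. [folklore] -/
theorem defect_eq_zero_of_D {k : ℕ}
    (h : ∀ t : σ →₀ ℕ, t.degree ≤ k → ∀ i j, defect b (monomial t 1) (b i) (b j) = 0) :
    ∀ p ∈ D σ R k, ∀ x y : L, defect b p x y = 0 := by
  intro p hp x y
  have hb : ∀ i j, defect b p (b i) (b j) = 0 := fun i j ↦ by
    have := eqOn_D (f := defectL b (b i) (b j)) (g := 0) (fun t ht ↦ by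
      rw [defectL_apply, h t ht i j, LinearMap.zero_apply]) p hp
    rwa [defectL_apply, LinearMap.zero_apply] at this
  rw [defect_eq_zero_of_basis b hb]
  rfl

/-- The case `j < i`, `j ≤ t` of condition (C): holds by construction.
[cite: Humphreys1972, §17.4, proof of Lemma A] -/
theorem defect_monomial_of_leAll {i j : σ} {t : σ →₀ ℕ} (hji : j < i) (hjt : LEAll j t) :
    defect b (monomial t 1) (b i) (b j) = 0 := by
  have e1 : act b (b j) (monomial t 1) = monomial (single j 1 + t) 1 := by
    rw [act_monomial_of_leAll b hjt, X_mul_monomial]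
  have e2 := act_monomial_single_add b hji hjt
  have e3 : act b (b j) (X i * monomial t 1) = X j * (X i * monomial t 1) := by
    rw [X_mul_monomial, act_monomial_of_leAll b (leAll_single_add_iff.mpr ⟨hji.le, hjt⟩)]
  rw [defect_apply, e1, e2, map_sub, e3, ← X_mul_monomial]
  ring

/-- Humphreys' Lemma 17.4.B computation: the hard case of condition (C), given (C) in lower
degrees. [cite: Humphreys1972, §17.4, Lemma B] -/
theorem act_act_monomial_single_add {i j k : σ} {P : σ →₀ ℕ} (hkP : LEAll k P) (hkj : k < j)
    (hki : k < i) (IH : ∀ p ∈ D σ R P.degree, ∀ x y : L, defect b p x y = 0) :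
    act b (b i) (act b (b j) (monomial (single k 1 + P) 1)) =
      act b (b k) (act b (b i) (act b (b j) (monomial P 1))) +
        act b ⁅b i, b k⁆ (act b (b j) (monomial P 1)) +
          act b (b i) (act b ⁅b j, b k⁆ (monomial P 1)) := by
  set w := act b (b j) (monomial P 1) - X j * monomial P 1 with hw_def
  have hw : w ∈ D σ R P.degree := act_monomial_sub_mem_D b j P
  have ezt : monomial (single k 1 + P) (1 : R) = act b (b k) (monomial P 1) := by
    rw [act_monomial_of_leAll b hkP, X_mul_monomial]
  have e1 : act b (b j) (act b (b k) (monomial P 1)) =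
      act b (b k) (act b (b j) (monomial P 1)) + act b ⁅b j, b k⁆ (monomial P 1) := by
    have := IH _ (monomial_mem_D le_rfl 1) (b j) (b k)
    rw [defect_apply] at this
    linear_combination this
  have e2 : act b (b j) (monomial P 1) = monomial (single j 1 + P) 1 + w := by
    rw [hw_def, X_mul_monomial]
    abel
  have e3 : defect b (monomial (single j 1 + P) 1) (b i) (b k) = 0 :=
    defect_monomial_of_leAll b hki (leAll_single_add_iff.mpr ⟨hkj.le, hkP⟩)
  have e4 : defect b w (b i) (b k) = 0 := IH w hw (b i) (b k)
  rw [defect_apply] at e3 e4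
  rw [ezt, e1, map_add, e2]
  simp only [map_add]
  linear_combination e3 + e4

/-- **Condition (C) of Humphreys' Lemma 17.4.A**: `x_i·(x_j·z_t) - x_j·(x_i·z_t) = [x_i,x_j]·z_t`
for all basis vectors and all monomials. [cite: Humphreys1972, §17.4, Lemmas A–B] -/
theorem defect_monomial_eq_zero (t : σ →₀ ℕ) (i j : σ) :
    defect b (monomial t 1) (b i) (b j) = 0 := by
  induction hd : t.degree using Nat.strong_induction_on generalizing t i j with
  | _ d ih =>
    have IH : ∀ P : σ →₀ ℕ, P.degree < d →
        ∀ p ∈ D σ R P.degree, ∀ x y : L, defect b p x y = 0 :=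
      fun P hP ↦ defect_eq_zero_of_D b fun t' ht' i' j' ↦
        ih t'.degree (lt_of_le_of_lt ht' hP) t' i' j' rfl
    suffices key : ∀ i j, j < i → defect b (monomial t 1) (b i) (b j) = 0 by
      rcases lt_trichotomy j i with h | rfl | h
      · exact key i j h
      · simp [defect_apply]
      · have := key j i h
        rw [defect_apply] at this ⊢
        rw [← lie_skew, map_neg, LinearMap.neg_apply]
        linear_combination -this
    intro i j hji
    by_cases hjt : LEAll j t
    · exact defect_monomial_of_leAll b hji hjt
    obtain ⟨k, P, rfl, hkP, hkj⟩ := exists_eq_single_add_of_not_leAll hjt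
    have hki : k < i := hkj.trans hji
    have hP : P.degree < d := by
      rw [← hd, degree_single_add]
      exact Nat.lt_succ_self _
    have IHP := IH P hP
    have e1 := act_act_monomial_single_add b hkP hkj hki IHP
    have e2 := act_act_monomial_single_add b hkP hki hkj IHP
    have zP := monomial_mem_D (le_refl P.degree) (1 : R)
    have e3 := congrArg (act b (b k)) (IHP _ zP (b i) (b j))
    have e4 := IHP _ zP ⁅b i, b k⁆ (b j)
    have e5 := IHP _ zP (b i) ⁅b j, b k⁆
    have e6 := IHP _ zP (b k) ⁅b i, b j⁆
    have jac : act b ⁅b k, ⁅b i, b j⁆⁆ (monomial P 1) + act b ⁅⁅b i, b k⁆, b j⁆ (monomial P 1) +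
        act b ⁅b i, ⁅b j, b k⁆⁆ (monomial P 1) = 0 := by
      rw [← LinearMap.add_apply, ← LinearMap.add_apply, ← map_add, ← map_add]
      have : ⁅b k, ⁅b i, b j⁆⁆ + ⁅⁅b i, b k⁆, b j⁆ + ⁅b i, ⁅b j, b k⁆⁆ = 0 := by
        rw [← lie_jacobi (b i) (b j) (b k), ← lie_skew (b k) (b i), lie_neg,
          ← lie_skew ⁅b i, b k⁆ (b j)]
        abel
      rw [this, map_zero, LinearMap.zero_apply]
    have ezt : monomial (single k 1 + P) (1 : R) = act b (b k) (monomial P 1) := by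
      rw [act_monomial_of_leAll b hkP, X_mul_monomial]
    rw [defect_apply, map_sub, map_sub, map_zero] at e3
    rw [defect_apply] at e4 e5 e6 ⊢
    rw [ezt] at e1 e2 ⊢
    linear_combination e1 - e2 + e3 + e4 + e5 + e6 + jac

/-- The action of `L` on `S(L)` is a Lie algebra representation.
[cite: Humphreys1972, §17.4, Lemma C] -/
theorem act_lie (x y : L) (p : S) :
    act b ⁅x, y⁆ p = act b x (act b y p) - act b y (act b x p) := by
  have hp : p ∈ D σ R (p.support.sup Finsupp.degree) :=
    mem_D_iff.mpr fun s hs ↦ Finset.le_sup hs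
  have h := defect_eq_zero_of_D b (fun t _ i j ↦ defect_monomial_eq_zero b t i j) p hp x y
  rw [defect_apply] at h
  linear_combination -h

/-- **Humphreys' Lemma 17.4.C.** The polynomial algebra `S = R[z_i : i ∈ σ]` is an `L`-module
with `x_i · z_s = z_i z_s` whenever `i ≤ s`. [cite: Humphreys1972, §17.4, Lemma C; §17.3 Theorem (PBW)] -/
def ρ : L →ₗ⁅R⁆ Module.End R S where
  toLinearMap := act b
  map_lie' := by
    intro x y
    change act b ⁅x, y⁆ = ⁅act b x, act b y⁆
    refine LinearMap.ext fun p ↦ ?_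
    rw [LieRing.of_associative_ring_bracket, LinearMap.sub_apply, Module.End.mul_apply,
      Module.End.mul_apply]
    exact act_lie b x y p

/-- Unfolding `ρ`. [folklore] -/
theorem ρ_apply (x : L) : ρ b x = act b x :=
  rfl

end Construction

/-! ### Ordered monomials in `U(L)`: linear independence, spanning, the PBW basis -/

section Envelope

open UniversalEnvelopingAlgebra

variable {L : Type*} [LieRing L] [LieAlgebra R L] (b : Module.Basis σ R L)

local notation "S" => MvPolynomial σ R
local notation "U" => UniversalEnvelopingAlgebra R L

/-- The word `ι(x_{l₁}) ⋯ ι(x_{l_k})` in `U(L)` attached to a list of indices (`x_i = b i`).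
[cite: Humphreys1972, §17.3] -/
def word (l : List σ) : U :=
  (l.map fun i ↦ ι R (b i)).prod

/-- The empty word is `1`. [folklore] -/
@[simp]
theorem word_nil : word b [] = 1 := by
  simp [word]

/-- `x_{i :: l} = ι(x_i) · x_l`. [folklore] -/
@[simp]
theorem word_cons (i : σ) (l : List σ) : word b (i :: l) = ι R (b i) * word b l := by
  simp [word]

/-- The word of `[i]` is `ι(x_i)`. [folklore] -/
theorem word_singleton (i : σ) : word b [i] = ι R (b i) := by
  simp

/-- Words are multiplicative under concatenation. [folklore] -/
theorem word_append (l l' : List σ) : word b (l ++ l') = word b l * word b l' := by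
  simp [word, List.prod_append]

/-- The defining relation of `U(L)`: `ι(x) ι(y) = ι(y) ι(x) + ι([x, y])`. [folklore] -/
theorem ι_mul_ι (x y : L) : ι R x * ι R y = ι R y * ι R x + ι R ⁅x, y⁆ := by
  rw [LieHom.map_lie, LieRing.of_associative_ring_bracket]
  abel

/-- The span of all words. It is all of `U(L)` (`span_word_eq_top`). [folklore] -/
theorem mul_mem_span_word {u v : U} (hu : u ∈ Submodule.span R (Set.range (word b)))
    (hv : v ∈ Submodule.span R (Set.range (word b))) :
    u * v ∈ Submodule.span R (Set.range (word b)) := by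
  refine Submodule.span_induction ?_ (by simp) (fun x y _ _ hx hy ↦ ?_) (fun a x _ hx ↦ ?_) hu
  · rintro _ ⟨l, rfl⟩
    refine Submodule.span_induction ?_ (by simp) (fun x y _ _ hx hy ↦ ?_) (fun a x _ hx ↦ ?_) hv
    · rintro _ ⟨l', rfl⟩
      rw [← word_append]
      exact Submodule.subset_span ⟨_, rfl⟩
    · rw [mul_add]
      exact add_mem hx hy
    · rw [mul_smul_comm]
      exact Submodule.smul_mem _ a hx
  · rw [add_mul]
    exact add_mem hx hy
  · rw [smul_mul_assoc]
    exact Submodule.smul_mem _ a hx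

/-- `U(L)` is spanned by the words in (the images of) the basis vectors. [cite: Humphreys1972, §17.2–17.3] -/
theorem span_word_eq_top : Submodule.span R (Set.range (word b)) = ⊤ := by
  rw [eq_top_iff]
  rintro u -
  obtain ⟨t, rfl⟩ : ∃ t, mkAlgHom R L t = u := RingCon.mkₐ_surjective _ u
  induction t using TensorAlgebra.induction with
  | algebraMap r =>
    rw [AlgHom.commutes, Algebra.algebraMap_eq_smul_one]
    exact Submodule.smul_mem _ r (Submodule.subset_span ⟨[], word_nil b⟩)
  | ι x =>
    rw [← ι_apply, ← b.linearCombination_repr x, Finsupp.linearCombination_apply,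
      map_finsuppSum]
    refine Submodule.finsuppSum_mem _ _ _ _ fun i _ ↦ ?_
    rw [map_smul]
    exact Submodule.smul_mem _ _ (Submodule.subset_span ⟨[i], by simp⟩)
  | mul a c ha hc =>
    rw [map_mul]
    exact mul_mem_span_word b ha hc
  | add a c ha hc =>
    rw [map_add]
    exact add_mem ha hc

variable [LinearOrder σ]

/-- The **ordered monomial** `ι(x_{i₁}) ι(x_{i₂}) ⋯ ι(x_{i_k})`, `i₁ ≤ i₂ ≤ ⋯ ≤ i_k`, attached to the
multi-index `s = ∑ single i_r 1 : σ →₀ ℕ`. These form the Poincaré–Birkhoff–Witt basis of `U(L)`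
(`pbwBasis`). [cite: Humphreys1972, §17.3, Corollary C] -/
def ordMonomial (s : σ →₀ ℕ) : U :=
  word b (Multiset.sort (toMultiset s))

/-- The ordered monomial of the empty multi-index is `1`. [folklore] -/
theorem ordMonomial_zero : ordMonomial b 0 = 1 := by
  simp [ordMonomial]

/-- `x_{(j, t)} = ι(x_j) · x_t` for `j ≤ t`. [cite: Humphreys1972, §17.3] -/
theorem ordMonomial_single_add {j : σ} {t : σ →₀ ℕ} (hjt : LEAll j t) :
    ordMonomial b (single j 1 + t) = ι R (b j) * ordMonomial b t := by
  rw [ordMonomial, ordMonomial, toMultiset_add, toMultiset_single, one_nsmul,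
    Multiset.singleton_add, Multiset.sort_cons, word_cons]
  exact fun k hk ↦ hjt k ((mem_toMultiset _ _).mp hk)

/-- The ordered monomial of a sorted list is its word. [folklore] -/
theorem ordMonomial_coe_eq_word {l : List σ} (hl : l.Pairwise (· ≤ ·)) :
    ordMonomial b (Multiset.toFinsupp (l : Multiset σ)) = word b l := by
  rw [ordMonomial, Multiset.toFinsupp_toMultiset]
  congr 1
  exact List.Perm.eq_of_pairwise (fun a b _ _ h₁ h₂ ↦ le_antisymm h₁ h₂)
    (Multiset.pairwise_sort _ _) hl (Multiset.coe_eq_coe.mp (Multiset.sort_eq _ _))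

/-- Evaluation of `u ∈ U(L)` on `1 ∈ S(L)` through the representation `ρ`: the linear map
`U(L) → S(L)` which identifies ordered monomials with monomials. [cite: Humphreys1972, §17.4, proof of Theorem 17.3] -/
def evalOne : U →ₗ[R] S :=
  LinearMap.applyₗ (1 : S) ∘ₗ (lift R (ρ b)).toLinearMap

/-- Unfolding `evalOne`. [folklore] -/
theorem evalOne_apply (u : U) : evalOne b u = lift R (ρ b) u 1 :=
  rfl

/-- `evalOne (ι(x) · u) = x · evalOne u`. [folklore] -/
theorem evalOne_ι_mul (x : L) (u : U) : evalOne b (ι R x * u) = act b x (evalOne b u) := by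
  rw [evalOne_apply, map_mul, lift_ι_apply, Module.End.mul_apply]
  rfl

/-- `evalOne 1 = 1`. [folklore] -/
@[simp]
theorem evalOne_one : evalOne b 1 = 1 := by
  simp [evalOne_apply]

/-- `evalOne` sends the ordered monomial `x_s` to the monomial `z_s`.
[cite: Humphreys1972, §17.4, proof of Theorem 17.3] -/
theorem evalOne_ordMonomial (s : σ →₀ ℕ) : evalOne b (ordMonomial b s) = monomial s 1 := by
  induction s using induction_on_min with
  | h0 => simp [ordMonomial_zero, evalOne_apply]
  | hadd j t hjt ih =>
    rw [ordMonomial_single_add b hjt, evalOne_ι_mul, ih, act_monomial_of_leAll b hjt,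
      X_mul_monomial]

/-- **PBW, linear independence half**: the ordered monomials in `U(L)` are linearly independent.
[cite: Humphreys1972, §17.3, Corollary C; §17.4] -/
theorem linearIndependent_ordMonomial : LinearIndependent R (ordMonomial b) := by
  apply LinearIndependent.of_comp (evalOne b)
  have : evalOne b ∘ ordMonomial b = fun s ↦ monomial s 1 := funext (evalOne_ordMonomial b)
  rw [this, ← coe_basisMonomials]
  exact (basisMonomials σ R).linearIndependent

/-- The standard filtration of `U(L)`, presented by sorted words: `fil k` is the span of the
words of sorted lists of length `≤ k` (equivalently of all words of length `≤ k`,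
`word_mem_fil_length`; equivalently of the ordered monomials of degree `≤ k`).
[cite: Humphreys1972, §17.3] -/
def fil (k : ℕ) : Submodule R U :=
  Submodule.span R {u | ∃ l : List σ, l.Pairwise (· ≤ ·) ∧ l.length ≤ k ∧ word b l = u}

/-- The filtration is increasing. [folklore] -/
theorem fil_mono : Monotone (fil b) := fun _ _ h ↦
  Submodule.span_mono fun _ ⟨l, hl, hk, hu⟩ ↦ ⟨l, hl, hk.trans h, hu⟩

/-- Sorted words of length `≤ k` lie in `fil k` (by definition). [folklore] -/
theorem word_mem_fil {l : List σ} (hl : l.Pairwise (· ≤ ·)) {k : ℕ} (hk : l.length ≤ k) :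
    word b l ∈ fil b k :=
  Submodule.subset_span ⟨l, hl, hk, rfl⟩

/-- Ordered monomials of degree `≤ k` lie in `fil k`. [cite: Humphreys1972, §17.3] -/
theorem ordMonomial_mem_fil {s : σ →₀ ℕ} {k : ℕ} (hs : s.degree ≤ k) : ordMonomial b s ∈ fil b k := by
  refine word_mem_fil b (Multiset.pairwise_sort _ _) ?_
  rwa [Multiset.length_sort, card_toMultiset]

/-- One level of straightening, from the previous levels. [folklore] -/
theorem ι_mul_mem_fil_of {k : ℕ}
    (ih : ∀ l : List σ, l.Pairwise (· ≤ ·) → l.length ≤ k → ∀ i : σ,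
      ι R (b i) * word b l - word b (l.orderedInsert (· ≤ ·) i) ∈ fil b k)
    (x : L) {u : U} (hu : u ∈ fil b k) : ι R x * u ∈ fil b (k + 1) := by
  have hbasis : ∀ i : σ, ∀ u ∈ fil b k, ι R (b i) * u ∈ fil b (k + 1) := by
    intro i u hu
    refine Submodule.span_induction ?_ (by simp) (fun x y _ _ hx hy ↦ ?_) (fun a x _ hx ↦ ?_) hu
    · rintro _ ⟨l, hl, hk, rfl⟩
      rw [← sub_add_cancel (ι R (b i) * word b l) (word b (l.orderedInsert (· ≤ ·) i))]
      refine add_mem (fil_mono b k.le_succ (ih l hl hk i)) (word_mem_fil b (hl.orderedInsert i l) ?_)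
      rw [List.orderedInsert_length]
      omega
    · rw [mul_add]
      exact add_mem hx hy
    · rw [mul_smul_comm]
      exact Submodule.smul_mem _ a hx
  rw [← b.linearCombination_repr x, Finsupp.linearCombination_apply, map_finsuppSum,
    Finsupp.sum_mul]
  refine Submodule.finsuppSum_mem _ _ _ _ fun i _ ↦ ?_
  rw [map_smul, smul_mul_assoc]
  exact Submodule.smul_mem _ _ (hbasis i u hu)

/-- **Straightening** (the spanning half of PBW, with the filtration): for a sorted list `l` of
length `≤ k`, `ι(x_i) · x_l ≡ x_{insert i l}` modulo words of sorted lists of length `≤ k`.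
[cite: Humphreys1972, §17.3, Lemma and §17.4 Lemma D] -/
theorem ι_mul_word_sub_mem (k : ℕ) :
    ∀ l : List σ, l.Pairwise (· ≤ ·) → l.length ≤ k → ∀ i : σ,
      ι R (b i) * word b l - word b (l.orderedInsert (· ≤ ·) i) ∈ fil b k := by
  induction k with
  | zero =>
    intro l hl hk i
    obtain rfl : l = [] := List.eq_nil_of_length_eq_zero (Nat.le_zero.mp hk)
    simp
  | succ k ih =>
    intro l hl hk i
    cases l with
    | nil => simp
    | cons j l' =>
      rw [List.orderedInsert_cons]
      split_ifs with hij
      · simp only [word_cons, sub_self, zero_mem]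
      · have hl' : l'.Pairwise (· ≤ ·) := (List.pairwise_cons.mp hl).2
        have hk' : l'.length ≤ k := by
          rw [List.length_cons] at hk
          omega
        rw [word_cons, word_cons, ← mul_assoc, ι_mul_ι, add_mul, mul_assoc]
        have h2 := ι_mul_mem_fil_of b ih (b j) (ih l' hl' hk' i)
        rw [mul_sub] at h2
        have h3 : ι R ⁅b i, b j⁆ * word b l' ∈ fil b (k + 1) :=
          ι_mul_mem_fil_of b ih _ (word_mem_fil b hl' hk')
        convert add_mem h2 h3 using 1
        abel

/-- Left multiplication by `ι(x)` raises the filtration by one. [cite: Humphreys1972, §17.3] -/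
theorem ι_mul_mem_fil {k : ℕ} (x : L) {u : U} (hu : u ∈ fil b k) : ι R x * u ∈ fil b (k + 1) :=
  ι_mul_mem_fil_of b (ι_mul_word_sub_mem b k) x hu

/-- Every word of length `≤ k` lies in `fil k`. [cite: Humphreys1972, §17.3] -/
theorem word_mem_fil_length (l : List σ) : word b l ∈ fil b l.length := by
  induction l with
  | nil => exact word_mem_fil b List.Pairwise.nil le_rfl
  | cons i l ih =>
    rw [word_cons]
    exact ι_mul_mem_fil b (b i) ih

/-- **Straightening**: a word is congruent to the word of its sorted rearrangement modulo
shorter words. [cite: Humphreys1972, §17.3, Lemma] -/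
theorem word_sub_word_insertionSort_mem {k : ℕ} :
    ∀ l : List σ, l.length ≤ k + 1 →
      word b l - word b (l.insertionSort (· ≤ ·)) ∈ fil b k := by
  induction k with
  | zero =>
    intro l hl
    match l, hl with
    | [], _ => simp
    | [i], _ => simp
  | succ k ih =>
    intro l hl
    cases l with
    | nil => simp
    | cons i l' =>
      rw [List.length_cons] at hl
      have hl' : l'.length ≤ k + 1 := by omega
      rw [List.insertionSort_cons, word_cons,
        ← sub_add_sub_cancel _ (ι R (b i) * word b (l'.insertionSort (· ≤ ·))) _, ← mul_sub]
      refine add_mem (ι_mul_mem_fil b (b i) (ih l' hl')) ?_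
      refine ι_mul_word_sub_mem b (k + 1) _ (List.pairwise_insertionSort _ _) ?_ i
      rw [List.length_insertionSort]
      exact hl'

/-- **PBW, spanning half**: the ordered monomials span `U(L)`. [cite: Humphreys1972, §17.3, Corollary C] -/
theorem span_ordMonomial_eq_top : Submodule.span R (Set.range (ordMonomial b)) = ⊤ := by
  rw [eq_top_iff, ← span_word_eq_top b, Submodule.span_le]
  rintro _ ⟨l, rfl⟩
  have h1 := word_sub_word_insertionSort_mem b (k := l.length) l (Nat.le_succ _)
  rw [← sub_add_cancel (word b l) (word b (l.insertionSort (· ≤ ·)))]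
  refine add_mem ?_ ?_
  · refine (Submodule.span_le.mpr ?_) h1
    rintro _ ⟨l', hl', -, rfl⟩
    rw [← ordMonomial_coe_eq_word b hl']
    exact Submodule.subset_span ⟨_, rfl⟩
  · rw [← ordMonomial_coe_eq_word b (List.pairwise_insertionSort _ _)]
    exact Submodule.subset_span ⟨_, rfl⟩

/-- **The Poincaré–Birkhoff–Witt theorem.** For a Lie algebra `L` over a commutative ring `R`
which is free as an `R`-module, with basis `(x_i)_{i ∈ σ}` indexed by a linearly ordered type,
the ordered monomials `ι(x_{i₁}) ⋯ ι(x_{i_k})`, `i₁ ≤ ⋯ ≤ i_k`, form an `R`-basis of the universal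
enveloping algebra `U(L)`. Humphreys, *Introduction to Lie Algebras and Representation Theory*,
§17.3 Corollary C (proof in §17.4, valid verbatim over any commutative ring);
Bourbaki, LIE I §2.7 Th. 1. [cite: Humphreys1972, §17.3 Corollary C and §17.4] -/
def pbwBasis : Module.Basis (σ →₀ ℕ) R U :=
  Module.Basis.mk (linearIndependent_ordMonomial b) (span_ordMonomial_eq_top b).ge

/-- The PBW basis vectors are the ordered monomials. [cite: Humphreys1972, §17.3, Corollary C] -/
@[simp]
theorem pbwBasis_apply (s : σ →₀ ℕ) : pbwBasis b s = ordMonomial b s :=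
  Module.Basis.mk_apply _ _ s

/-- Every word of length `≤ k` lies in `fil k`. [cite: Humphreys1972, §17.3] -/
theorem word_mem_fil_of_length_le {l : List σ} {k : ℕ} (h : l.length ≤ k) : word b l ∈ fil b k :=
  fil_mono b h (word_mem_fil_length b l)

/-- The filtration is the standard one: `fil k` is the span of *all* words of length `≤ k`.
[cite: Humphreys1972, §17.3] -/
theorem fil_eq_span_word (k : ℕ) :
    fil b k = Submodule.span R {u | ∃ l : List σ, l.length ≤ k ∧ word b l = u} :=
  le_antisymm (Submodule.span_mono fun _ ⟨l, _, hk, hu⟩ ↦ ⟨l, hk, hu⟩)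
    (Submodule.span_le.mpr fun _ ⟨_, hk, hu⟩ ↦ hu ▸ word_mem_fil_of_length_le b hk)

/-- The filtration is multiplicative: `fil j · fil k ⊆ fil (j + k)`. [cite: Humphreys1972, §17.3] -/
theorem mul_mem_fil {j k : ℕ} {u v : U} (hu : u ∈ fil b j) (hv : v ∈ fil b k) :
    u * v ∈ fil b (j + k) := by
  rw [fil_eq_span_word] at hu hv
  refine Submodule.span_induction ?_ (by simp) (fun x y _ _ hx hy ↦ ?_) (fun a x _ hx ↦ ?_) hu
  · rintro _ ⟨l, hl, rfl⟩
    refine Submodule.span_induction ?_ (by simp) (fun x y _ _ hx hy ↦ ?_) (fun a x _ hx ↦ ?_) hv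
    · rintro _ ⟨l', hl', rfl⟩
      rw [← word_append]
      refine word_mem_fil_of_length_le b ?_
      rw [List.length_append]
      omega
    · rw [mul_add]
      exact add_mem hx hy
    · rw [mul_smul_comm]
      exact Submodule.smul_mem _ a hx
  · rw [add_mul]
    exact add_mem hx hy
  · rw [smul_mul_assoc]
    exact Submodule.smul_mem _ a hx

/-- `ι(L) ⊆ fil 1`. [folklore] -/
theorem ι_mem_fil_one (x : L) : ι R x ∈ fil b 1 := by
  rw [← b.linearCombination_repr x, Finsupp.linearCombination_apply, map_finsuppSum]
  refine Submodule.finsuppSum_mem _ _ _ _ fun i _ ↦ ?_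
  rw [map_smul, ← word_singleton b]
  exact Submodule.smul_mem _ _ (word_mem_fil_of_length_le b (by simp))

/-- Right multiplication by `ι(x)` raises the filtration by one. [cite: Humphreys1972, §17.3] -/
theorem mul_ι_mem_fil {k : ℕ} {u : U} (hu : u ∈ fil b k) (x : L) : u * ι R x ∈ fil b (k + 1) :=
  mul_mem_fil b hu (ι_mem_fil_one b x)

/-- The degree of the multi-index of a list is its length. [folklore] -/
theorem degree_toFinsupp_coe (l : List σ) :
    (Multiset.toFinsupp (l : Multiset σ)).degree = l.length := by
  have h := card_toMultiset (Multiset.toFinsupp (l : Multiset σ))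
  rw [Multiset.toFinsupp_toMultiset, Multiset.coe_card] at h
  rw [h]
  rfl

/-- `fil k` is the span of the ordered monomials of degree `≤ k`. [cite: Humphreys1972, §17.3, Corollary C] -/
theorem fil_eq_span_ordMonomial (k : ℕ) :
    fil b k = Submodule.span R (ordMonomial b '' {s | s.degree ≤ k}) := by
  apply le_antisymm
  · refine Submodule.span_le.mpr ?_
    rintro _ ⟨l, hl, hk, rfl⟩
    rw [← ordMonomial_coe_eq_word b hl]
    refine Submodule.subset_span ⟨_, ?_, rfl⟩
    show Finsupp.degree _ ≤ k
    rwa [degree_toFinsupp_coe]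
  · refine Submodule.span_le.mpr ?_
    rintro _ ⟨s, hs, rfl⟩
    exact ordMonomial_mem_fil b hs

/-- **Straightening**, PBW form: a word of length `≤ k + 1` is congruent to the ordered monomial
with the same indices modulo `fil k`. [cite: Humphreys1972, §17.3, Lemma; §17.4 Lemma D] -/
theorem word_sub_ordMonomial_mem {k : ℕ} {l : List σ} (hl : l.length ≤ k + 1) :
    word b l - ordMonomial b (Multiset.toFinsupp (l : Multiset σ)) ∈ fil b k := by
  have h := word_sub_word_insertionSort_mem b l hl
  rwa [← ordMonomial_coe_eq_word b (List.pairwise_insertionSort _ _),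
    Multiset.coe_eq_coe.mpr (List.perm_insertionSort _ _)] at h

/-- Membership in `fil k` in PBW coordinates: all ordered monomials occurring have degree `≤ k`.
[cite: Humphreys1972, §17.3, Corollary C] -/
theorem mem_fil_iff_repr {k : ℕ} {u : U} :
    u ∈ fil b k ↔ ∀ s, (pbwBasis b).repr u s ≠ 0 → s.degree ≤ k := by
  constructor
  · intro hu s hs
    by_contra h
    apply hs
    rw [fil_eq_span_ordMonomial] at hu
    have key := LinearMap.eqOn_span (R := R) (f := Finsupp.lapply s ∘ₗ (pbwBasis b).repr.toLinearMap)
      (g := 0) (s := ordMonomial b '' {s | s.degree ≤ k}) ?_ hu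
    · simpa using key
    · rintro _ ⟨t, ht, rfl⟩
      have hts : t ≠ s := fun hts ↦ h (hts ▸ ht)
      simp [← pbwBasis_apply, hts]
  · intro h
    rw [← (pbwBasis b).linearCombination_repr u, Finsupp.linearCombination_apply]
    refine Submodule.finsuppSum_mem _ _ _ _ fun s hs ↦ Submodule.smul_mem _ _ ?_
    rw [pbwBasis_apply]
    exact ordMonomial_mem_fil b (h s hs)

/-- `evalOne ∘ ι` is the linear embedding `L → S(L)`, `x_i ↦ z_i`. [folklore] -/
theorem evalOne_comp_ι :
    evalOne b ∘ₗ (ι R : L →ₗ⁅R⁆ U).toLinearMap =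
      Finsupp.linearCombination R X ∘ₗ b.repr.toLinearMap := by
  refine b.ext fun i ↦ ?_
  have h1 : (1 : S) = monomial 0 1 := by simp
  simp only [LinearMap.comp_apply, LieHom.coe_toLinearMap, LinearEquiv.coe_toLinearMap,
    Module.Basis.repr_self, Finsupp.linearCombination_single, one_smul]
  rw [← mul_one (ι R (b i)), evalOne_ι_mul, evalOne_one, h1,
    act_monomial_of_leAll b (leAll_zero i), ← h1, mul_one]

include b in
/-- **PBW, corollary**: the canonical map `ι : L → U(L)` is injective (for `L` free over `R`).
[cite: Humphreys1972, §17.3, Corollary B] -/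
theorem ι_injective : Function.Injective (ι R : L → U) := by
  intro x y hxy
  have hx := LinearMap.congr_fun (evalOne_comp_ι b) x
  have hy := LinearMap.congr_fun (evalOne_comp_ι b) y
  simp only [LinearMap.comp_apply, LieHom.coe_toLinearMap, LinearEquiv.coe_toLinearMap] at hx hy
  rw [hxy] at hx
  exact b.repr.injective (linearIndependent_X σ R (hx.symm.trans hy))

end Envelope

end Literature.Algebra.Lie.PBW
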